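import Literature.Probability.RandomPlanarGeometry.SLEKappaRhoMartingaleAlgebra
import HarnessLib

/-!
# [LSW] Lemma 8.9, the drift identity in slid/divided-difference coordinates

G. F. Lawler, O. Schramm, W. Werner, *Conformal restriction: the chordal case*, J. Amer. Math.
Soc. **16** (2003) 917–955, arXiv:math/0209343 (**[LSW]**), proof of Lemma 8.9: "Using these
expressions in Itô's formula for `dM_t`, one can now compute the semi-martingale decomposition of
`M_t`. This is tedious but straightforward, so we omit the detailed calculation here. […] The lemma
follows as this drift term vanishes for the appropriate choice of `b` and `c`."

`SLEKappaRhoMartingaleAlgebra.itoDriftRatio_eq_zero` proves the vanishing in the printed variables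
(`h(W), h'(W), h''(W), h(O), h'(O), W, O`). The tree's conditional-increment proof of Lemma 8.9
expands `log M = ell E_B ρ x y` (`SLEKappaRhoLogGamma`) at `(0, o)`, `o = O_t − W_t = −Z_t`, with
the closed-form coefficients of `SLEKappaRhoLogGammaJets` — `∂ₓell`, `∂_y ell`, `∂ₓ²ell` — and the
time derivative `λ` of `ell` along the hull evolution `E ↦ E + 2u D`,
`D(z) = d²/E(z) − E'(z)/z` ([LSW] (5.1); `Loewner.driftFun`, `D(0) = −(3/2)E''(0)`,
`D'(0) = E''(0)²/(4E'(0)) − (2/3)E'''(0)`, `LoewnerImageStepJet`). In the jet variables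
`o`, `e₀ = E(o)`, `e₁ = E'(o)`, `e₂ = E''(o)`, `d = E'(0)`, `c₂ = E''(0)`, `c₃ = E'''(0)` these are
the rational functions `jetL1`, `jetM1`, `jetL2`, `jetLam` below, and this file PROVES the drift
identity of Lemma 8.9 in this form:

  `ρ ℓ₁/Z − 2 m₁/Z + λ + (4/3)(ℓ₂ + ℓ₁²) = 0`,   `Z = −o`,  `κ/2 = 4/3`,

for `b = ρ(4 + 3ρ)/32`, `c = 3ρ/8` (`jetDrift_eq_zero`, by `field_simp; ring`): the coefficient of
`J = 1/Z` (the terms driven by `dW ∋ ρ dt/Z` and `dO = −2 dt/Z`), the `dt`-terms at fixed `W, O`,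
and the Itô correction `½ κ (∂ₓ²L + (∂ₓL)²)` of `M = exp L` cancel. No named facts; four
definitions (the rational functions) and the identity.

## References

* [LSW] §8.4, proof of Lemma 8.9; §5 (5.1). [LawlerSchrammWerner2003Restriction]
* G. F. Lawler, *Conformally Invariant Processes in the Plane* (2005), (4.35)–(4.37). [Lawler2005]
-/

noncomputable section

namespace Literature.Probability.RandomPlanarGeometry

namespace SLEKappaRho

variable {K : Type*} [Field K]

/-- `ℓ₁ = ∂ₓell(0, o) = (5/8) c₂/d + c (1/o − d/e₀)` (`deriv_ell_left_eq`): the `dB`-coefficient of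
`dL` is `√κ ℓ₁`. [cite: LawlerSchrammWerner2003Restriction, proof of Lemma 8.9 (∂_W L)] -/
def jetL1 (c o e₀ d c₂ : K) : K := 5 / 8 * (c₂ / d) + c * (1 / o - d / e₀)

/-- `m₁ = ∂_y ell(0, o) = b e₂/e₁ + c (e₁/e₀ − 1/o)` (`deriv_ell_right_eq`).
[cite: LawlerSchrammWerner2003Restriction, proof of Lemma 8.9 (∂_O L)] -/
def jetM1 (b c o e₀ e₁ e₂ : K) : K := b * (e₂ / e₁) + c * (e₁ / e₀ - 1 / o)

/-- `ℓ₂ = ∂ₓ²ell(0, o)` (`iteratedDeriv_two_ell_left_eq`), with `N₀ = e₀ − o d`, `N₁ = −o c₂`,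
`D₀ = o e₀`, `D₁ = −(e₀ + o d)`. [cite: LawlerSchrammWerner2003Restriction, proof of Lemma 8.9 (Itô's formula for dM_t)] -/
def jetL2 (c o e₀ d c₂ c₃ : K) : K :=
  5 / 8 * ((c₃ * d - c₂ * c₂) / d ^ 2) +
    c * ((-(o * c₂)) * (o * e₀) - (e₀ - o * d) * (-(e₀ + o * d))) / (o * e₀) ^ 2

/-- `λ = ∂_t ell(0, o)` along `E ↦ E + 2u D`, `D = d²/E − E'/z`:
`λ = (5/8)·2D'(0)/d + b·2D'(o)/e₁ + c·2(D(o) − D(0))/e₀` with `D(0) = −(3/2)c₂`,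
`D'(0) = c₂²/(4d) − (2/3)c₃`, `D(o) = d²/e₀ − e₁/o`, `D'(o) = −d²e₁/e₀² − e₂/o + e₁/o²` (the third
term is `c · 2 DQ_D(0,o)/DQ_E(0,o)` with `DQ_D(0,o) = (D(o) − D(0))/o`, `DQ_E(0,o) = e₀/o`).
[cite: LawlerSchrammWerner2003Restriction, §5 (5.1) and proof of Lemma 8.9 (d[h(O)], d[h'(O)], ∂_t h'(W))] -/
def jetLam (b c o e₀ e₁ e₂ d c₂ c₃ : K) : K :=
  5 / 8 * (2 * (c₂ ^ 2 / (4 * d) - 2 / 3 * c₃) / d) +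
    b * (2 * (-(d ^ 2 * e₁ / e₀ ^ 2) - e₂ / o + e₁ / o ^ 2) / e₁) +
    c * (2 * ((d ^ 2 / e₀ - e₁ / o) - (-(3 / 2 * c₂))) / e₀)

/-- **[LSW] Lemma 8.9, the drift identity**: for `b = ρ(4 + 3ρ)/32`, `c = 3ρ/8` and every value
of the jet variables (`o, e₀, e₁, d ≠ 0`),
`ρ ℓ₁/(−o) − 2 m₁/(−o) + λ + (4/3)(ℓ₂ + ℓ₁²) = 0` — the drift of `dM/M` per `dt`, namely
`J·(ρ ∂ₓL − 2 ∂_yL) + ∂_tL + (κ/2)(∂ₓ²L + (∂ₓL)²)` with `J = 1/Z = 1/(−o)` and `κ = 8/3`, vanishes.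
This is the omitted "tedious but straightforward" computation, in the tree's coordinates.
[cite: LawlerSchrammWerner2003Restriction, Lemma 8.9 and its proof] -/
theorem jetDrift_eq_zero (ρ : K) {o e₀ e₁ d : K} (ho : o ≠ 0) (he₀ : e₀ ≠ 0) (he₁ : e₁ ≠ 0)
    (hd : d ≠ 0) (e₂ c₂ c₃ : K) (h2 : (2 : K) ≠ 0) (h3 : (3 : K) ≠ 0) :
    let b : K := ρ * (4 + 3 * ρ) / 32
    let c : K := 3 * ρ / 8
    ρ * jetL1 c o e₀ d c₂ / (-o) - 2 * jetM1 b c o e₀ e₁ e₂ / (-o) + jetLam b c o e₀ e₁ e₂ d c₂ c₃ +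
      4 / 3 * (jetL2 c o e₀ d c₂ c₃ + jetL1 c o e₀ d c₂ ^ 2) = 0 := by
  intro b c
  simp only [jetL1, jetM1, jetL2, jetLam, b, c]
  have h4 : (4 : K) ≠ 0 := by
    have : (4 : K) = 2 * 2 := by norm_num
    rw [this]; exact mul_ne_zero h2 h2
  have h8 : (8 : K) ≠ 0 := by
    have : (8 : K) = 2 * 4 := by norm_num
    rw [this]; exact mul_ne_zero h2 h4
  have h32 : (32 : K) ≠ 0 := by
    have : (32 : K) = 4 * 8 := by norm_num
    rw [this]; exact mul_ne_zero h4 h8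
  field_simp
  ring

/-- The identity over `ℂ` with the tree's exponents `expB ρ`, `expC ρ`.
[cite: LawlerSchrammWerner2003Restriction, Lemma 8.9 and its proof] -/
theorem jetDrift_eq_zero_complex (ρ : ℝ) {o e₀ e₁ d : ℂ} (ho : o ≠ 0) (he₀ : e₀ ≠ 0) (he₁ : e₁ ≠ 0)
    (hd : d ≠ 0) (e₂ c₂ c₃ : ℂ) :
    (ρ : ℂ) * jetL1 (expC ρ : ℂ) o e₀ d c₂ / (-o) - 2 * jetM1 (expB ρ : ℂ) (expC ρ : ℂ) o e₀ e₁ e₂ / (-o) +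
        jetLam (expB ρ : ℂ) (expC ρ : ℂ) o e₀ e₁ e₂ d c₂ c₃ +
      4 / 3 * (jetL2 (expC ρ : ℂ) o e₀ d c₂ c₃ + jetL1 (expC ρ : ℂ) o e₀ d c₂ ^ 2) = 0 := by
  have hb : (expB ρ : ℂ) = (ρ : ℂ) * (4 + 3 * (ρ : ℂ)) / 32 := by unfold expB; push_cast; ring
  have hc : (expC ρ : ℂ) = 3 * (ρ : ℂ) / 8 := by unfold expC; push_cast; ring
  rw [hb, hc]
  exact jetDrift_eq_zero (ρ : ℂ) ho he₀ he₁ hd e₂ c₂ c₃ two_ne_zero three_ne_zero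

end SLEKappaRho

end Literature.Probability.RandomPlanarGeometry

end
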